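/-
Copyright (c) 2026 the pub-hodgecm-mathlib formalisation cell (harness21).  Prover seat hodgecm-mathlib-K2E3-p34 (g2), Track B «K2-LIT» ∕ h413 = `stmt-HodgeConjecture-24833`,
line `K2_E3_EllipticInputs`, unit U4 «Keys», socket :182 `sig_K2E3KeysThmTwoContractingRamifiedCharOnePosDepth`, programme A_pos^{<}: brick (v)-θ^{<}-CM «THE TWO-DEPTH
(CONCAVE-LEVEL) IWAHORI CHARACTER ON `U(Φ₃)(L⁺_v)`» — `θ(g) = χ₁(g₀₀)` is multiplicative on `J_e = eA⁻¹(Jg)` in the ROCHE regime (cond_F χ₁ = c < n = cond_E χ₁); the `J_e`-twin of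
★ `K2E3LevelNIwahoriCharacterCM` (K2E3-p37 (g0)), CM dress of ★ `K2E3ConcaveLevelIwahoriCharacter` (this seat); dealer K2E3-plan (g5), K2 bus 2026-09-04T22:40:45Z.
-/
import Summits.HodgeConjecture.HodgeConjecture.Theorems.K2E3DepthZeroIwahoriCharacterCM      -- ★ Z2A-3b (K2E3-p06 (g4)): the (G3) frame, `coe_eA_apply`, `isUnit_of_apply_ne_zero`
import Summits.HodgeConjecture.HodgeConjecture.Theorems.K2E3ConcaveLevelIwahoriCharacter     -- ★ p862449 (this seat): MODEL `mk0_mul_apply_zero_zero_eq`-free building blocks `mul_apply_zero_zero_eq`, `row_zero_rel`, `col_zero_rel`, `one_add_mul_add_mul_eq`, `sigma_add_mul_eq_neg`, `v_beta_mul_zeta_le`, `v_traceOne_correction_le`, `v_mul_le_pow_add`, `v_pow_le_pow_of_le`; brings ★ D174 (pivot `v_apply_zero_zero_eq_one_of_mem`, letters `e Jg hJg`)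
import HarnessLib

/-!
# K2 ∕ E3 «EllipticInputs», unit U4 «Keys» — (U4f-χ₁-ram-one-pos), programme A_pos^{<} brick (v)-θ^{<}-CM: THE TWO-DEPTH IWAHORI CHARACTER ON `U(Φ₃)(L⁺_v)` —
# `θ(g) = χ₁(g₀₀)` IS MULTIPLICATIVE ON `J_e = eA⁻¹(Jg)` FOR `χ₁` OF E-CONDUCTOR `≤ n` AND F-CONDUCTOR `≤ c` UNDER THE CONCAVITY INEQUALITIES
# [Roche1998 §3; MoyPrasad1996 §3; BruhatTits1972 (4.4.4), (6.4.9); PlatonovRapinchuk1994 §5.1]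

Cell hodgecm-mathlib, Track B «K2-LIT», crux item H413 = stmt-HodgeConjecture-24833 (route `HCCMUnconditional`, no route verbs); target BY NAME the OPEN tier-0 leaf
`…K2E3EllipticInputs.U4Keys.sig_K2E3KeysThmTwoContractingRamifiedCharOnePosDepth` (U4Keys :182), regime A_pos^{<}.  Author K2E3-p34 (g2).  `--supports stmt-HodgeConjecture-24833
--as helper`; THEOREMS ONLY.  Frame = the (G3)-EXPLICIT frame of ★ Z2A-3b (`L v w hw eA heA ϖ hϖ`) plus ★ D174's model letters `e Jg hJg` and ★ (v)-CM^{<}'s `Je (hJe : Je = Jg.comap eA)`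
(K2E3-p14 (g9), ★ `K2E3IwahoriTwoDepthLettersCM`).  NOT THE PAYER of :182.

THE POINT.  ★ V2b's letter `hθmul` wants `θ(g) := χ₁(g₀₀)` (if `g₀₀` is a unit of `L ⊗ L⁺_v`, else `0`) MULTIPLICATIVE on the type group.  For the uniform `J_n` this is ★
`theta_mul_pow` (cond `χ₁ ≤ n`: `|(jj′)₀₀ − j₀₀j′₀₀|_w ≤ |ϖ|ⁿ`).  On the two-depth group `J_e` of A_pos^{<} (upper depths `r = e 0 1`, `s = e 0 2`, lower `r′ = e 1 0`, `s′ = e 2 0`, long-root sum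
`s + s′ = c = cond_F χ₁ < n = cond_E χ₁`) that bound fails and the model theorem ★ `chi_mul_apply_zero_zero_of_traceOne` replaces it: with the unit pivots,
`(jj′)₀₀ = j₀₀·j′₀₀·(1 + ỹx̃ + b̃z̃)` and `1 + ỹx̃ + b̃z̃ = (1 + βζ) + E`, `βζ` `σ_w`-FIXED with `|βζ|_w ≤ |ϖ|^c`, `|E|_w ≤ |ϖ|ⁿ` (trace-one `t`, concavity `n ≤ r + r′`, `n ≤ 2r + s′`,
`n ≤ s + 2r′`, `c ≤ s + s′`, `1 ≤ c ≤ n`).  THIS FILE reads that decomposition in `L ⊗ L⁺_v = ∏_{w′ ∣ v} L_{w′}` (ONE place `w` over the non-split `v`): the unit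
`U = (jj′)₀₀ ∕ (j₀₀ j′₀₀)` of `L ⊗ L⁺_v` factors as `U_F · U_E` with `U_F` (the element with `w`-component `1 + βζ`) `(c ⊗ 1)`-FIXED and `≡ 1 (mod 𝔭_w^c)`, and `U_E ≡ 1 (mod 𝔭_wⁿ)`,
so `χ₁ U = 1` for `χ₁ : (L ⊗ L⁺_v)ˣ → ℂˣ` trivial on `{u : ∀ w′, |u_{w′} − 1| ≤ |ϖ|ⁿ}` (letter `hcond`, ★ p861880's shape) AND on the `(c ⊗ 1)`-fixed `{u : σu = u, ∀ w′, |u_{w′} − 1| ≤ |ϖ|^c}`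
(NEW letter `hcondF` — «cond_F χ₁ ≤ c»).
* §1 `map_mem_of_mem` (`j ∈ Je ⟹ eA j ∈ Jg`), `isUnit_apply_zero_zero_of_mem` (the pivot, `1 ≤ e 1 0`, `1 ≤ e 2 0`), `isUnit_update_of_ne_zero` ∕ `conjLocal_update_fixed` (the one-place unit
  `U_F` and its `(c ⊗ 1)`-invariance).
* §2 **`chi_unit_apply_zero_zero_mul_concave`** (`χ₁((jj′)₀₀) = χ₁(j₀₀)·χ₁(j′₀₀)` on `Je`, Roche regime) and **`theta_mul_concave`** (the letter `hθmul` at `B = Je`).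
HONEST LABEL: HC_CM is proved only modulo the 7 printed citations (2 remaining named inputs: hLiu418 = stmt-HodgeConjecture-24832, h413 = stmt-HodgeConjecture-24833)
until rung 0 closes; count-neutral — this file does NOT pay the leaf; no printed citation is discharged.

## References
* [Roche1998] A. Roche, *Types and Hecke algebras for principal series representations of split reductive p-adic groups*, Ann. Sci. ÉNS (4) 31 (1998), §3 (the character `χ̃` of `J_χ`).
* [MoyPrasad1996] A. Moy, G. Prasad, *Jacquet functors and unrefined minimal K-types*, Comment. Math. Helv. 71 (1996), §3.
* [BruhatTits1972] F. Bruhat, J. Tits, *Groupes réductifs sur un corps local I*, Publ. Math. IHÉS 41 (1972), (4.4.4), (6.4.9).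
* [PlatonovRapinchuk1994] V. Platonov, A. Rapinchuk, *Algebraic Groups and Number Theory* (1994), §5.1 (the one-place model at a non-split place).
-/

set_option autoImplicit false
-- the mandated namespace has the single-problem summit's repeated segment (`HodgeConjecture.HodgeConjecture`)
set_option linter.dupNamespace false

noncomputable section

open NumberField IsDedekindDomain
open scoped Matrix MatrixGroups WithZero Valued
open Literature.NumberTheory Literature.NumberTheory.Automorphic Literature.NumberTheory.Automorphic.UnitaryGroup
open Literature.NumberTheory.Rogawski1990

namespace Summit.HodgeConjecture.HodgeConjecture.Cruxes.H413.K2E3ConcaveLevelIwahoriCharacterCM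

open Summit.HodgeConjecture.HodgeConjecture.Cruxes.H413
open Summit.HodgeConjecture.HodgeConjecture.Cruxes.H413.K2E3DepthZeroIwahoriCharacterCM

variable (L : Type) [Field L] [NumberField L] [IsCMField L] (v : HeightOneSpectrum (𝓞 ↥(maximalRealSubfield L)))
  (w : PlacesOver L v) (hw : IsCMField.complexConj L • w.1 = w.1)
  (eA : Gqs L v ≃ₜ* ↥(unitaryGroupOfForm (galAdicCompletionMap (L := L) (IsCMField.complexConj L) hw) ((StdForm.antidiagonal 3).over (w.1.adicCompletion L))))
  (heA : ∀ g : Gqs L v,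
    ((eA g : ↥(unitaryGroupOfForm (galAdicCompletionMap (L := L) (IsCMField.complexConj L) hw) ((StdForm.antidiagonal 3).over (w.1.adicCompletion L)))) :
        GL (Fin 3) (w.1.adicCompletion L)) =
      ((localNonsplitEquiv (IsCMField.complexConj L) (qsForm L) (IsCMField.complexConj_ne_one L) w hw g :
        ↥(unitaryGroupOfForm (galAdicCompletionMap (L := L) (IsCMField.complexConj L) hw) (placeForm (qsForm L) w.1))) : GL (Fin 3) (w.1.adicCompletion L)))
  {ϖ : w.1.adicCompletion L} (hϖ : Valued.v ϖ = WithZero.exp (-1 : ℤ))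
  (e : Fin 3 → Fin 3 → ℕ)
  (Jg : Subgroup ↥(unitaryGroupOfForm (galAdicCompletionMap (L := L) (IsCMField.complexConj L) hw) ((StdForm.antidiagonal 3).over (w.1.adicCompletion L))))
  (hJg : ∀ k : ↥(unitaryGroupOfForm (galAdicCompletionMap (L := L) (IsCMField.complexConj L) hw) ((StdForm.antidiagonal 3).over (w.1.adicCompletion L))),
    k ∈ Jg ↔ ∀ i j, Valued.v (((k : GL (Fin 3) (w.1.adicCompletion L)) : Matrix (Fin 3) (Fin 3) (w.1.adicCompletion L)) i j) ≤ Valued.v ϖ ^ e i j)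
  (Je : Subgroup (Gqs L v)) (hJe : Je = Jg.comap eA.toMulEquiv.toMonoidHom)

/-! ## §1 `eA` sends `Je` into `Jg`; the pivot; the one-place unit `U_F` -/

include hJe in
/-- `j ∈ Je = Jg.comap eA` ⟹ `eA j ∈ Jg`. [cite: BruhatTits1972, (6.4.9)] -/
theorem map_mem_of_mem {j : Gqs L v} (hj : j ∈ Je) : eA j ∈ Jg := by
  subst hJe; exact hj

include heA hϖ hJg hJe in
/-- **For `j ∈ Je` the entry `j₀₀ ∈ L ⊗ L⁺_v` is a unit** when the two lower exponents of column `0` are positive (`1 ≤ e 1 0`, `1 ≤ e 2 0`): its `w`-component `(eA j)₀₀` is a `w`-adic unit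
(★ D174 `v_apply_zero_zero_eq_one_of_mem`), and `v` is non-split (★ `isUnit_of_apply_ne_zero`). [cite: BruhatTits1972, (4.4.4)] [cite: PlatonovRapinchuk1994, §5.1] -/
theorem isUnit_apply_zero_zero_of_mem (h10 : 1 ≤ e 1 0) (h20 : 1 ≤ e 2 0) {j : Gqs L v} (hj : j ∈ Je) :
    IsUnit (((j.val : GL (Fin 3) (LocalRing L v)) : Matrix (Fin 3) (Fin 3) (LocalRing L v)) 0 0) := by
  refine isUnit_of_apply_ne_zero L v w hw _ ?_
  rw [← coe_eA_apply L v w hw eA heA j 0 0]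
  intro h
  have hv := K2E3IwahoriTwoDepthFactorisation.v_apply_zero_zero_eq_one_of_mem (galAdicCompletionMap (L := L) (IsCMField.complexConj L) hw) rfl
    (fun x => valued_galAdicCompletionMap (L := L) (IsCMField.complexConj L) hw x) hϖ e Jg hJg h10 h20 (map_mem_of_mem L v w hw eA Jg Je hJe hj)
  rw [h, map_zero] at hv
  exact zero_ne_one hv

open Classical in
include hw in
/-- The one-place element with `w`-component `y ≠ 0` is a unit of `L ⊗ L⁺_v` (★ `isUnit_of_apply_ne_zero`). [cite: PlatonovRapinchuk1994, §5.1] -/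
theorem isUnit_update_of_ne_zero {y : w.1.adicCompletion L} (hy : y ≠ 0) : IsUnit (Function.update (0 : LocalRing L v) w y) := by
  refine isUnit_of_apply_ne_zero L v w hw _ ?_
  rw [Function.update_self]
  exact hy

open Classical in
include hw in
/-- **`(c ⊗ 1)`-invariance of the one-place unit**: if `σ_w y = y` then the unit of `L ⊗ L⁺_v` with `w`-component `y` is fixed by `conjLocal` (★ `conjLocal_apply_eq_of_smul_eq`: `(c ⊗ 1)` reads
at the one place as `σ_w`). [cite: PlatonovRapinchuk1994, §5.1] -/
theorem conjLocal_update_fixed {y : w.1.adicCompletion L} (hy : y ≠ 0) (hσy : galAdicCompletionMap (L := L) (IsCMField.complexConj L) hw y = y) :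
    Units.map (conjLocal L (IsCMField.complexConj L) v : LocalRing L v →* LocalRing L v) (isUnit_update_of_ne_zero L v w hw hy).unit =
      (isUnit_update_of_ne_zero L v w hw hy).unit := by
  apply Units.ext
  funext w'
  obtain rfl := (PlacesOver.eq_of_smul_eq (IsCMField.complexConj L) (IsCMField.complexConj_ne_one L) w hw w').symm
  rw [Units.coe_map, MonoidHom.coe_coe, IsUnit.unit_spec, conjLocal_apply_eq_of_smul_eq (IsCMField.complexConj L) (IsCMField.complexConj_ne_one L) v w hw,
    Function.update_self, hσy]

/-! ## §2 Multiplicativity of `θ(g) = χ₁(g₀₀)` on `Je` in the Roche regime -/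

open Classical in
include heA hϖ hJg hJe in
set_option maxHeartbeats 400000 in
-- the statement's `IsUnit` binders on `L ⊗ L⁺_v`-valued matrix entries time out at `whnf` under the default 200000 (measured; class of ★ `K2E3IwahoriTwoDepthLettersCM`)
/-- **`χ₁((jj′)₀₀) = χ₁(j₀₀)·χ₁(j′₀₀)` for `j, j′ ∈ Je` IN THE ROCHE REGIME.**  Exponents: `1 ≤ e 1 0`, `1 ≤ e 2 0` (pivot) and the concavity inequalities
`n ≤ e 0 1 + e 1 0`, `n ≤ 2·e 0 1 + e 2 0`, `n ≤ e 0 2 + 2·e 1 0`, `c ≤ e 0 2 + e 2 0`, `1 ≤ c ≤ n`; `χ₁ : (L ⊗ L⁺_v)ˣ → ℂˣ` with `hcond` (E-conductor `≤ n`: `χ₁ u = 1` if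
`|u_{w′} − 1| ≤ |ϖ|ⁿ` for all `w′`) and `hcondF` (F-conductor `≤ c`: `χ₁ u = 1` if `(c ⊗ 1) u = u` and `|u_{w′} − 1| ≤ |ϖ|^c` for all `w′`); a trace-one `t ∈ L_w`.  Proof: the unit
`U = (jj′)₀₀ (j₀₀ j′₀₀)⁻¹` has `w`-component `1 + ỹx̃ + b̃z̃ = (1 + βζ) + E` (★ `mul_apply_zero_zero_eq`, ★ `one_add_mul_add_mul_eq`, ★ `row_zero_rel` ∕ `col_zero_rel` through `eA`);
`U_F :=` the one-place unit of `1 + βζ` is `(c ⊗ 1)`-fixed (★ `sigma_add_mul_eq_neg`) with `|βζ| ≤ |ϖ|^c` (★ `v_beta_mul_zeta_le`), so `χ₁ U_F = 1`; `U·U_F⁻¹ ≡ 1 (mod 𝔭ⁿ)`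
(★ `v_traceOne_correction_le`), so `χ₁(U·U_F⁻¹) = 1`. [cite: Roche1998, §3] [cite: MoyPrasad1996, §3] [cite: BruhatTits1972, (6.4.9)] [cite: PlatonovRapinchuk1994, §5.1] -/
theorem chi_unit_apply_zero_zero_mul_concave (h10e : 1 ≤ e 1 0) (h20e : 1 ≤ e 2 0) (χ₁ : (LocalRing L v)ˣ →* ℂˣ) {n c : ℕ} (hc1 : 1 ≤ c) (hcn : c ≤ n)
    (hcond : ∀ u : (LocalRing L v)ˣ, (∀ w' : PlacesOver L v, Valued.v (((u : LocalRing L v) w') - 1) ≤ Valued.v ϖ ^ n) → χ₁ u = 1)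
    (hcondF : ∀ u : (LocalRing L v)ˣ, Units.map (conjLocal L (IsCMField.complexConj L) v : LocalRing L v →* LocalRing L v) u = u →
      (∀ w' : PlacesOver L v, Valued.v (((u : LocalRing L v) w') - 1) ≤ Valued.v ϖ ^ c) → χ₁ u = 1)
    {t : w.1.adicCompletion L} (ht : t + galAdicCompletionMap (L := L) (IsCMField.complexConj L) hw t = 1) (hvt : Valued.v t ≤ 1)
    (h1 : n ≤ e 0 1 + e 1 0) (h2 : n ≤ 2 * e 0 1 + e 2 0) (h3 : n ≤ e 0 2 + 2 * e 1 0) (h4 : c ≤ e 0 2 + e 2 0)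
    {j j' : Gqs L v} (hj : j ∈ Je) (hj' : j' ∈ Je)
    (h0 : IsUnit ((((j * j').val : GL (Fin 3) (LocalRing L v)) : Matrix (Fin 3) (Fin 3) (LocalRing L v)) 0 0))
    (hu1 : IsUnit (((j.val : GL (Fin 3) (LocalRing L v)) : Matrix (Fin 3) (Fin 3) (LocalRing L v)) 0 0))
    (hu2 : IsUnit (((j'.val : GL (Fin 3) (LocalRing L v)) : Matrix (Fin 3) (Fin 3) (LocalRing L v)) 0 0)) :
    χ₁ h0.unit = χ₁ hu1.unit * χ₁ hu2.unit := by
  -- abbreviations for the place model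
  have hσσ : ∀ x, (galAdicCompletionMap (L := L) (IsCMField.complexConj L) hw) ((galAdicCompletionMap (L := L) (IsCMField.complexConj L) hw) x) = x :=
    galAdicCompletionMap_galAdicCompletionMap_of_smul_eq (IsCMField.complexConj L) w (IsCMField.complexConj_ne_one L) hw
  have hvσ : ∀ x, Valued.v (galAdicCompletionMap (L := L) (IsCMField.complexConj L) hw x) = Valued.v x :=
    fun x => valued_galAdicCompletionMap (L := L) (IsCMField.complexConj L) hw x
  have hvϖ1 : Valued.v ϖ < 1 := by rw [hϖ, ← WithZero.exp_zero, WithZero.exp_lt_exp]; norm_num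
  have hvϖc : Valued.v ϖ ^ c < 1 := pow_lt_one' hvϖ1 (Nat.one_le_iff_ne_zero.1 hc1)
  have hjg := map_mem_of_mem L v w hw eA Jg Je hJe hj
  have hj'g := map_mem_of_mem L v w hw eA Jg Je hJe hj'
  -- the three entries at the place `w`, and the normalised coordinates
  set A : w.1.adicCompletion L := ((j.val : GL (Fin 3) (LocalRing L v)) : Matrix (Fin 3) (Fin 3) (LocalRing L v)) 0 0 w with hA
  set a' : w.1.adicCompletion L := ((j'.val : GL (Fin 3) (LocalRing L v)) : Matrix (Fin 3) (Fin 3) (LocalRing L v)) 0 0 w with ha'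
  have hAe : (((eA j : ↥(unitaryGroupOfForm (galAdicCompletionMap (L := L) (IsCMField.complexConj L) hw) ((StdForm.antidiagonal 3).over (w.1.adicCompletion L)))) :
      GL (Fin 3) (w.1.adicCompletion L)) : Matrix (Fin 3) (Fin 3) (w.1.adicCompletion L)) 0 0 = A := coe_eA_apply L v w hw eA heA j 0 0
  have ha'e : (((eA j' : ↥(unitaryGroupOfForm (galAdicCompletionMap (L := L) (IsCMField.complexConj L) hw) ((StdForm.antidiagonal 3).over (w.1.adicCompletion L)))) :
      GL (Fin 3) (w.1.adicCompletion L)) : Matrix (Fin 3) (Fin 3) (w.1.adicCompletion L)) 0 0 = a' := coe_eA_apply L v w hw eA heA j' 0 0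
  have hvA : Valued.v A = 1 := by
    rw [← hAe]
    exact K2E3IwahoriTwoDepthFactorisation.v_apply_zero_zero_eq_one_of_mem _ rfl hvσ hϖ e Jg hJg h10e h20e hjg
  have hva' : Valued.v a' = 1 := by
    rw [← ha'e]
    exact K2E3IwahoriTwoDepthFactorisation.v_apply_zero_zero_eq_one_of_mem _ rfl hvσ hϖ e Jg hJg h10e h20e hj'g
  have hA0 : A ≠ 0 := fun h => by rw [h, map_zero] at hvA; exact zero_ne_one hvA
  have ha'0 : a' ≠ 0 := fun h => by rw [h, map_zero] at hva'; exact zero_ne_one hva'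
  have hA0e : (((eA j : ↥(unitaryGroupOfForm (galAdicCompletionMap (L := L) (IsCMField.complexConj L) hw) ((StdForm.antidiagonal 3).over (w.1.adicCompletion L)))) :
      GL (Fin 3) (w.1.adicCompletion L)) : Matrix (Fin 3) (Fin 3) (w.1.adicCompletion L)) 0 0 ≠ 0 := by rw [hAe]; exact hA0
  have ha'0e : (((eA j' : ↥(unitaryGroupOfForm (galAdicCompletionMap (L := L) (IsCMField.complexConj L) hw) ((StdForm.antidiagonal 3).over (w.1.adicCompletion L)))) :
      GL (Fin 3) (w.1.adicCompletion L)) : Matrix (Fin 3) (Fin 3) (w.1.adicCompletion L)) 0 0 ≠ 0 := by rw [ha'e]; exact ha'0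
  set y : w.1.adicCompletion L := (((eA j : ↥(unitaryGroupOfForm (galAdicCompletionMap (L := L) (IsCMField.complexConj L) hw) ((StdForm.antidiagonal 3).over
      (w.1.adicCompletion L)))) : GL (Fin 3) (w.1.adicCompletion L)) : Matrix (Fin 3) (Fin 3) (w.1.adicCompletion L)) 0 1 / A with hy
  set b : w.1.adicCompletion L := (((eA j : ↥(unitaryGroupOfForm (galAdicCompletionMap (L := L) (IsCMField.complexConj L) hw) ((StdForm.antidiagonal 3).over
      (w.1.adicCompletion L)))) : GL (Fin 3) (w.1.adicCompletion L)) : Matrix (Fin 3) (Fin 3) (w.1.adicCompletion L)) 0 2 / A with hb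
  set x : w.1.adicCompletion L := (((eA j' : ↥(unitaryGroupOfForm (galAdicCompletionMap (L := L) (IsCMField.complexConj L) hw) ((StdForm.antidiagonal 3).over
      (w.1.adicCompletion L)))) : GL (Fin 3) (w.1.adicCompletion L)) : Matrix (Fin 3) (Fin 3) (w.1.adicCompletion L)) 1 0 / a' with hx
  set z : w.1.adicCompletion L := (((eA j' : ↥(unitaryGroupOfForm (galAdicCompletionMap (L := L) (IsCMField.complexConj L) hw) ((StdForm.antidiagonal 3).over
      (w.1.adicCompletion L)))) : GL (Fin 3) (w.1.adicCompletion L)) : Matrix (Fin 3) (Fin 3) (w.1.adicCompletion L)) 2 0 / a' with hz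
  -- the product entry at `w`: `P = A a′ (1 + y x + b z)`
  have hP : (((j * j').val : GL (Fin 3) (LocalRing L v)) : Matrix (Fin 3) (Fin 3) (LocalRing L v)) 0 0 w = A * a' * (1 + y * x + b * z) := by
    rw [← coe_eA_apply L v w hw eA heA (j * j') 0 0, map_mul, hy, hb, hx, hz, ← hAe, ← ha'e]
    exact K2E3ConcaveLevelIwahoriCharacter.mul_apply_zero_zero_eq _ (eA j) (eA j') hA0e ha'0e
  -- the isotropy relations and the entry bounds
  have hrow : b + galAdicCompletionMap (L := L) (IsCMField.complexConj L) hw b + y * galAdicCompletionMap (L := L) (IsCMField.complexConj L) hw y = 0 := by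
    rw [hb, hy, ← hAe]
    exact K2E3ConcaveLevelIwahoriCharacter.row_zero_rel _ rfl hσσ (eA j) hA0e
  have hcol : z + galAdicCompletionMap (L := L) (IsCMField.complexConj L) hw z + x * galAdicCompletionMap (L := L) (IsCMField.complexConj L) hw x = 0 := by
    rw [hz, hx, ← ha'e]
    exact K2E3ConcaveLevelIwahoriCharacter.col_zero_rel _ rfl (eA j') ha'0e
  have hvy : Valued.v y ≤ Valued.v ϖ ^ e 0 1 := by rw [hy, map_div₀, hvA, div_one]; exact ((hJg _).1 hjg) 0 1
  have hvb : Valued.v b ≤ Valued.v ϖ ^ e 0 2 := by rw [hb, map_div₀, hvA, div_one]; exact ((hJg _).1 hjg) 0 2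
  have hvx : Valued.v x ≤ Valued.v ϖ ^ e 1 0 := by rw [hx, map_div₀, hva', div_one]; exact ((hJg _).1 hj'g) 1 0
  have hvz : Valued.v z ≤ Valued.v ϖ ^ e 2 0 := by rw [hz, map_div₀, hva', div_one]; exact ((hJg _).1 hj'g) 2 0
  -- the decomposition `1 + yx + bz = (1 + βζ) + E`
  set β : w.1.adicCompletion L := b + t * (y * galAdicCompletionMap (L := L) (IsCMField.complexConj L) hw y) with hβ
  set ζ : w.1.adicCompletion L := z + t * (x * galAdicCompletionMap (L := L) (IsCMField.complexConj L) hw x) with hζ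
  have hσβ : galAdicCompletionMap (L := L) (IsCMField.complexConj L) hw β = -β := K2E3ConcaveLevelIwahoriCharacter.sigma_add_mul_eq_neg _ hσσ ht hrow
  have hσζ : galAdicCompletionMap (L := L) (IsCMField.complexConj L) hw ζ = -ζ := K2E3ConcaveLevelIwahoriCharacter.sigma_add_mul_eq_neg _ hσσ ht hcol
  have hvβζ : Valued.v (β * ζ) ≤ Valued.v ϖ ^ c :=
    K2E3ConcaveLevelIwahoriCharacter.v_beta_mul_zeta_le _ hvσ hϖ hvt hvy hvb hvx hvz hcn h1 h2 h3 h4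
  have hvF : Valued.v (1 + β * ζ) = 1 := Valued.v.map_one_add_of_lt (hvβζ.trans_lt hvϖc)
  have hF0 : 1 + β * ζ ≠ 0 := fun h => by rw [h, map_zero] at hvF; exact zero_ne_one hvF
  have hσF : galAdicCompletionMap (L := L) (IsCMField.complexConj L) hw (1 + β * ζ) = 1 + β * ζ := by
    rw [map_add, map_one, map_mul, hσβ, hσζ, neg_mul_neg]
  have hE := K2E3ConcaveLevelIwahoriCharacter.v_traceOne_correction_le _ hvσ hϖ hvt hvy hvb hvx hvz h1 h2 h3
  have hdecomp := K2E3ConcaveLevelIwahoriCharacter.one_add_mul_add_mul_eq (galAdicCompletionMap (L := L) (IsCMField.complexConj L) hw) t y b x z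
  -- the one-place unit `U_F` of `1 + βζ`: `(c ⊗ 1)`-fixed, `≡ 1 (mod 𝔭^c)`, killed by `χ₁`
  have hUF := isUnit_update_of_ne_zero L v w hw hF0
  have hχF : χ₁ hUF.unit = 1 := by
    refine hcondF _ (conjLocal_update_fixed L v w hw hF0 hσF) fun w' => ?_
    obtain rfl := PlacesOver.eq_of_smul_eq (IsCMField.complexConj L) (IsCMField.complexConj_ne_one L) w hw w'
    rw [IsUnit.unit_spec, Function.update_self, add_sub_cancel_left]
    exact hvβζ
  -- the quotient `U · U_F⁻¹` is `≡ 1 (mod 𝔭ⁿ)` at the one place, killed by `χ₁`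
  have hχE : χ₁ (h0.unit * (hu1.unit * hu2.unit)⁻¹ * hUF.unit⁻¹) = 1 := by
    refine hcond _ fun w' => ?_
    obtain rfl := PlacesOver.eq_of_smul_eq (IsCMField.complexConj L) (IsCMField.complexConj_ne_one L) w hw w'
    rw [Units.val_mul, Units.val_inv_eq_inv_val, Units.val_mul, Units.val_inv_eq_inv_val, Units.val_mul, IsUnit.unit_spec, IsUnit.unit_spec, IsUnit.unit_spec,
      IsUnit.unit_spec, Pi.mul_apply, Pi.inv_apply, Pi.mul_apply, Pi.inv_apply, Pi.mul_apply, Function.update_self, hP, ← hA, ← ha',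
      show A * a' * (1 + y * x + b * z) * (A * a')⁻¹ * (1 + β * ζ)⁻¹ - 1 = ((1 + y * x + b * z) - (1 + β * ζ)) * (1 + β * ζ)⁻¹ by field_simp,
      map_mul, map_inv₀, hvF, inv_one, mul_one, hdecomp, hβ, hζ, add_sub_cancel_left]
    exact hE
  rw [map_mul, map_mul, map_inv, map_inv, hχF, inv_one, mul_one, mul_inv_eq_one] at hχE
  rw [hχE, map_mul]

open Classical in
include heA hϖ hJg hJe in
/-- **`θ(jj′) = θ(j)·θ(j′)` ON `Je` IN THE ROCHE REGIME** for `θ(g) := if h : IsUnit g₀₀ then χ₁(h.unit) else 0` — the letter `hθmul` of ★ V2b at `B = Je` for A_pos^{<}, the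
two-depth twin of ★ `theta_mul_pow` (uniform `J_n`) and ★ Z2A-3b `theta_mul` (depth zero). [cite: Roche1998, §3] [cite: MoyPrasad1996, §3] [cite: BruhatTits1972, (6.4.9)] -/
theorem theta_mul_concave (h10e : 1 ≤ e 1 0) (h20e : 1 ≤ e 2 0) (χ₁ : (LocalRing L v)ˣ →* ℂˣ) {n c : ℕ} (hc1 : 1 ≤ c) (hcn : c ≤ n)
    (hcond : ∀ u : (LocalRing L v)ˣ, (∀ w' : PlacesOver L v, Valued.v (((u : LocalRing L v) w') - 1) ≤ Valued.v ϖ ^ n) → χ₁ u = 1)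
    (hcondF : ∀ u : (LocalRing L v)ˣ, Units.map (conjLocal L (IsCMField.complexConj L) v : LocalRing L v →* LocalRing L v) u = u →
      (∀ w' : PlacesOver L v, Valued.v (((u : LocalRing L v) w') - 1) ≤ Valued.v ϖ ^ c) → χ₁ u = 1)
    {t : w.1.adicCompletion L} (ht : t + galAdicCompletionMap (L := L) (IsCMField.complexConj L) hw t = 1) (hvt : Valued.v t ≤ 1)
    (h1 : n ≤ e 0 1 + e 1 0) (h2 : n ≤ 2 * e 0 1 + e 2 0) (h3 : n ≤ e 0 2 + 2 * e 1 0) (h4 : c ≤ e 0 2 + e 2 0)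
    {j j' : Gqs L v} (hj : j ∈ Je) (hj' : j' ∈ Je) :
    (if h : IsUnit ((((j * j').val : GL (Fin 3) (LocalRing L v)) : Matrix (Fin 3) (Fin 3) (LocalRing L v)) 0 0) then ((χ₁ h.unit : ℂˣ) : ℂ) else 0) =
      (if h : IsUnit (((j.val : GL (Fin 3) (LocalRing L v)) : Matrix (Fin 3) (Fin 3) (LocalRing L v)) 0 0) then ((χ₁ h.unit : ℂˣ) : ℂ) else 0) *
        (if h : IsUnit (((j'.val : GL (Fin 3) (LocalRing L v)) : Matrix (Fin 3) (Fin 3) (LocalRing L v)) 0 0) then ((χ₁ h.unit : ℂˣ) : ℂ) else 0) := by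
  have h0 := isUnit_apply_zero_zero_of_mem L v w hw eA heA hϖ e Jg hJg Je hJe h10e h20e (Subgroup.mul_mem _ hj hj')
  have hu1 := isUnit_apply_zero_zero_of_mem L v w hw eA heA hϖ e Jg hJg Je hJe h10e h20e hj
  have hu2 := isUnit_apply_zero_zero_of_mem L v w hw eA heA hϖ e Jg hJg Je hJe h10e h20e hj'
  rw [dif_pos h0, dif_pos hu1, dif_pos hu2, ← Units.val_mul,
    chi_unit_apply_zero_zero_mul_concave L v w hw eA heA hϖ e Jg hJg Je hJe h10e h20e χ₁ hc1 hcn hcond hcondF ht hvt h1 h2 h3 h4 hj hj' h0 hu1 hu2]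

end Summit.HodgeConjecture.HodgeConjecture.Cruxes.H413.K2E3ConcaveLevelIwahoriCharacterCM

end
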